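import Literature.Computability.Cryptography.BLPRSSection4AssemblyExplicit
import HarnessLib

/-!
# BLPRS §4 assembled: tolerance to APPROXIMATE candidates

Topic `Computability/Cryptography` (LWE), grouping namespace `BLPRS2013`; addendum to `BLPRSSection4AssemblyExplicit.lean` (`section4_selected_explicit`: explicit candidate
vector `candVec`, approximate raising noise, approximate measurement). The h₃ MACHINE realises each candidate only up to statistical error (its fresh coins are residues of
coin words, its Gaussians come from samplers): its candidate `Ẽᵢ` has acceptance probabilities within `ν_E` of `candVec … i` on the two laws that matter. This file records
that the selection guarantee survives with `η⋆ − 2ν_E` (everything PROVED; no definition; no named fact):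

* `distinguishingAdvantage_ge_of_acceptProb_close` — `Adv[Ẽ] ≥ Adv[E] − 2ν` when the two acceptance probabilities move by `≤ ν`;
* `exists_candVec_advantage_ge` — some explicit candidate has advantage `≥ η⋆` (the case analysis inside `section4_selected_explicit`, exported);
* **`section4_selected_explicit_close`** — `section4_selected_explicit` for ANY candidate vector `Ẽ` that is `ν_E`-close to `candVec` in that sense:
  `Adv_{Ψ̄_Q(α₂)}[selectWith Ẽ N_sel Est] ≥ (η⋆ − 2ν_E)/2 − 2·3·32/(N_sel (η⋆ − 2ν_E)²) − 2δ`.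

## References

* Z. Brakerski, A. Langlois, C. Peikert, O. Regev, D. Stehlé, *Classical hardness of learning with errors*, STOC 2013; arXiv:1306.0281, Thm. 4.1 (proof) and §5
  ("all the distributions … can be sampled efficiently up to negligible statistical distance"). [BrakerskiEtAl2013]
* O. Goldreich, *Foundations of Cryptography I*, CUP 2001, §3.2.1. [Goldreich2001]
-/

noncomputable section

open MeasureTheory Literature.Algebra.EuclideanLattices Literature.Probability.Distributions Literature.Algebra.Module
open scoped Real ENNReal

namespace Literature.Computability.Cryptography

namespace BLPRS2013

open LWE LWE.MP12

/-- **Close acceptance probabilities give close advantages**: if `Ẽ`'s acceptance probabilities on `A_{s,χ}^m` (`s ← U`) and on `U^m` are within `ν` of `E`'s,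
then `Adv[Ẽ] ≥ Adv[E] − 2ν`. [cite: Goldreich2001, §3.2.1] -/
theorem distinguishingAdvantage_ge_of_acceptProb_close {ι : Type} [Fintype ι] [DecidableEq ι] {R : Type} [CommRing R] [Fintype R] (χ : PMF R) {m : ℕ}
    (E E' : Distinguisher ι R m) {ν : ℝ}
    (h₁ : |(acceptProb E' (lweSamplesUniformSecret χ m)).toReal - (acceptProb E (lweSamplesUniformSecret χ m)).toReal| ≤ ν)
    (h₂ : |(acceptProb E' (uniformSamples ι R m)).toReal - (acceptProb E (uniformSamples ι R m)).toReal| ≤ ν) :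
    distinguishingAdvantage χ m E - 2 * ν ≤ distinguishingAdvantage χ m E' := by
  unfold distinguishingAdvantage
  rw [abs_le] at h₁ h₂
  have := abs_sub_abs_le_abs_sub ((acceptProb E (lweSamplesUniformSecret χ m)).toReal - (acceptProb E (uniformSamples ι R m)).toReal)
    ((acceptProb E' (lweSamplesUniformSecret χ m)).toReal - (acceptProb E' (uniformSamples ι R m)).toReal)
  have habs : |((acceptProb E (lweSamplesUniformSecret χ m)).toReal - (acceptProb E (uniformSamples ι R m)).toReal) -
      ((acceptProb E' (lweSamplesUniformSecret χ m)).toReal - (acceptProb E' (uniformSamples ι R m)).toReal)| ≤ 2 * ν := by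
    rw [abs_le]; constructor <;> linarith [h₁.1, h₁.2, h₂.1, h₂.2]
  linarith

section Selected

variable {n Q q' d : ℕ} [NeZero Q] [NeZero q'] {r B : ℝ} {G : ℕ} {τ : Fin G → ℝ} {m₃ N N' mfel : ℕ} {θ : ℝ}

/-- **Some explicit candidate has advantage `≥ η⋆`** (the three-way case analysis inside `section4_selected_explicit`, exported).
[cite: BrakerskiEtAl2013, Thm. 4.1 (proof), Cor. 3.2, Lemma 2.15, p. 13 and §5] -/
theorem exists_candVec_advantage_ge {ε α₀ α₂ u η₀ L47 ν νu : ℝ} (hn : 0 < n) (hε : 0 < ε) (hε' : ε ≤ 1 / 2)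
    (hr : max (Q : ℝ)⁻¹ (q' : ℝ)⁻¹ * Real.sqrt (2 * Real.log (2 * n * (1 + 1 / ε)) / π) ≤ r) (hα₀ : 0 < α₀) (hα₂ : 0 < α₂)
    (hG : 0 < G) (hN : 0 < N) (hN' : 0 < N') (hm₃ : 0 < m₃) (hθ : 0 < θ)
    (K : (Fin m₃ → (Fin n → ZMod q') × ZMod q') → PMF Bool)
    (A' : Distinguisher (Fin n) (ZMod Q) (G * (N * m₃)))
    (hA' : ∀ P : PMF (Fin (G * (N * m₃)) → (Fin n → ZMod Q) × ZMod Q),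
      |(acceptProb A' P).toReal -
        (acceptProb (flatGuessTest K N m₃ (rateGuessKernel n Q q' r B τ m₃) (uniformSamples (Fin n) (ZMod q') m₃) N' θ) P).toReal| ≤ ν)
    (χN : PMF (Fin n → ℤ)) (ρ₀ : (Fin n → ZMod Q) → ℝ) (ζ : PMF (Fin n → ℤ))
    (hζ : ∀ z ∈ ζ.support, ∀ i, z i = 0 ∨ z i = 1)
    (hnoise : ∀ z ∈ ζ.support, (noiseH₁ χN (discretizedGaussian Q (Real.sqrt (α₂ ^ 2 + u ^ 2))) (intCastVec z : Fin n → ZMod Q)).tvDist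
      (discretizedGaussian Q (ρ₀ (intCastVec z))) ≤ η₀)
    (hζ' : ∀ z ∈ ζ.support, ‖intVecToEuclidean n z‖ ≤ B ∧ α₀ ≤ ρ₀ (intCastVec z) ∧
      ∃ w : Fin G, 4 * θ ≤ distinguishingAdvantage (discretizedGaussian q'
        (Real.sqrt (Real.sqrt (ρ₀ (intCastVec z) ^ 2 + r ^ 2 * (‖intVecToEuclidean n z‖ ^ 2 + B ^ 2)) ^ 2 + τ w ^ 2))) m₃ K)
    (hεθ : m₃ * (4 * ε) ≤ θ / 2) (hQθ : m₃ * (2 / (α₀ * Q) + 10 * ε) + m₃ * η₀ ≤ 2 * θ)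
    (R47 : R47Type n d Q mfel)
    (h47 : ∀ ζ' : PMF (Fin n → ℤ), (∀ z ∈ ζ'.support, ∀ i, z i = 0 ∨ z i = 1) →
      ∀ D : (Fin n → ℤ) × (Matrix (Fin (d + 1)) (Fin n) (ZMod Q) × (Fin 1 → (Fin n → ZMod Q) × ℤ)) → PMF Bool,
        extLWEAdvantageZ ζ' χN 1 D ≤ felAdvantage (discretizedGaussian Q α₂) mfel (R47 ζ' D) + L47)
    (χut : PMF (ZMod Q)) (hχut : χut.tvDist (discretizedGaussian Q u) ≤ νu)
    {ηstar : ℝ}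
    (hη : ηstar ≤ (1 - ((G + 1) * (4 / (N * θ ^ 2)) + 8 / (N' * θ ^ 2)) - 2 * ν -
          (lawCz (d + 1) ζ).tvDist (PMF.uniformOfFintype (Matrix (Fin (d + 1)) (Fin n) (ZMod Q) × (Fin (d + 1) → ZMod Q))) -
          2 * (G * (N * m₃) : ℕ) * (∑ p ∈ Q.primeFactors, ((p : ℝ) ^ (d + 1))⁻¹ + L47)) / (2 * (G * (N * m₃) : ℕ) + 1) -
        (G * (N * m₃) : ℕ) * (1 / (2 * Q * α₂)) - 2 * ((max (G * (N * m₃)) mfel : ℕ) * νu))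
 :
    haveI : NeZero (G * (N * m₃)) := ⟨(Nat.mul_pos hG (Nat.mul_pos hN hm₃)).ne'⟩
    ∃ i, ηstar ≤ distinguishingAdvantage (discretizedGaussian Q α₂) (max (G * (N * m₃)) mfel)
      (candVec (discretizedGaussian Q (Real.sqrt (α₂ ^ 2 + u ^ 2))) χN ζ χut R47 A' i) := by
  haveI : NeZero (G * (N * m₃)) := ⟨(Nat.mul_pos hG (Nat.mul_pos hN hm₃)).ne'⟩
  set χh := discretizedGaussian Q (Real.sqrt (α₂ ^ 2 + u ^ 2)) with hχh
  set E₁ := candE₁ χh χN ζ (G * (N * m₃)) mfel R47 A' with hE₁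
  set E₃ := candE₃ χN (G * (N * m₃)) mfel R47 A' with hE₃
  set E₂ := candE₂ (k := d) χN (G * (N * m₃)) A' with hE₂
  -- Thm. 4.1's bookkeeping (explicit) and the ideal test's advantage (`section4_three_candidates_of_close`'s argument, explicit)
  have hsum : 1 - ((G + 1) * (4 / (N * θ ^ 2)) + 8 / (N' * θ ^ 2)) - 2 * ν -
      (lawCz (d + 1) ζ).tvDist (PMF.uniformOfFintype (Matrix (Fin (d + 1)) (Fin n) (ZMod Q) × (Fin (d + 1) → ZMod Q))) ≤
      ((G * (N * m₃) : ℕ) : ℝ) * (distinguishingAdvantage (discretizedGaussian Q α₂) mfel E₁ + (∑ p ∈ Q.primeFactors, ((p : ℝ) ^ (d + 1))⁻¹ + L47)) +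
        distinguishingAdvantage χh (G * (N * m₃)) E₂ +
        ((G * (N * m₃) : ℕ) : ℝ) * (distinguishingAdvantage (discretizedGaussian Q α₂) mfel E₃ + (∑ p ∈ Q.primeFactors, ((p : ℝ) ^ (d + 1))⁻¹ + L47)) := by
    set A := flatGuessTest K N m₃ (rateGuessKernel n Q q' r B τ m₃) (uniformSamples (Fin n) (ZMod q') m₃) N' θ with hA
    have hbound := blprs_theorem_4_1_bound_explicit (k := d) χh χN ζ (G * (N * m₃)) mfel R47 (fun s => noiseH₁ χN χh s) (discretizedGaussian Q α₂) hζ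
      (η := 0) (L47 := L47) (fun z => by rw [PMF.tvDist_self]) h47 A'
    have hadv := advantage_rateGuess_hybridH₀' (r := r) (B := B) (τ := τ) (N := N) (N' := N') hn hε hε' hr hα₀ hN hN' hθ K
      (fun s => noiseH₁ χN χh s) ρ₀ ζ (fun z hz => ?_) hεθ hQθ
    · rw [mul_zero, zero_add] at hbound
      rw [← hA] at hadv
      have h₁ := hA' (hybridH₀ (fun s => noiseH₁ χN χh s) (G * (N * m₃)) ζ)
      have h₂ := hA' (uniformSamples (Fin n) (ZMod Q) (G * (N * m₃)))
      rw [abs_le] at h₁ h₂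
      have hle := le_abs_self ((acceptProb A' (hybridH₀ (fun s => noiseH₁ χN χh s) (G * (N * m₃)) ζ)).toReal -
        (acceptProb A' (uniformSamples (Fin n) (ZMod Q) (G * (N * m₃)))).toReal)
      rw [← hE₁, ← hE₂, ← hE₃] at hbound
      linarith [h₁.1, h₁.2, h₂.1, h₂.2]
    · obtain ⟨hB, hρ, w, hw⟩ := hζ' z hz
      exact ⟨hB, hρ, hnoise z hz, w, hw⟩
  -- the three padded / raised candidates and the best one
  have hmM : (G * (N * m₃)) ≤ max (G * (N * m₃)) mfel := le_max_left _ _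
  have hfM : mfel ≤ max (G * (N * m₃)) mfel := le_max_right _ _
  have hA₁ : distinguishingAdvantage (discretizedGaussian Q α₂) (max (G * (N * m₃)) mfel) (padThen hfM E₁) = distinguishingAdvantage (discretizedGaussian Q α₂) mfel E₁ :=
    distinguishingAdvantage_padThen _ hfM E₁
  have hA₃ : distinguishingAdvantage (discretizedGaussian Q α₂) (max (G * (N * m₃)) mfel) (padThen hfM E₃) = distinguishingAdvantage (discretizedGaussian Q α₂) mfel E₃ :=
    distinguishingAdvantage_padThen _ hfM E₃
  have hA₂ : distinguishingAdvantage χh (G * (N * m₃)) E₂ - ((G * (N * m₃) : ℕ) : ℝ) * (1 / (2 * Q * α₂)) - 2 * ((max (G * (N * m₃)) mfel : ℕ) * νu) ≤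
      distinguishingAdvantage (discretizedGaussian Q α₂) (max (G * (N * m₃)) mfel) (raiseThen χut (max (G * (N * m₃)) mfel) (padThen hmM E₂)) := by
    have hideal : distinguishingAdvantage χh (G * (N * m₃)) E₂ - ((G * (N * m₃) : ℕ) : ℝ) * (1 / (2 * Q * α₂)) ≤
        distinguishingAdvantage (discretizedGaussian Q α₂) (max (G * (N * m₃)) mfel) (raiseThen (discretizedGaussian Q u) (max (G * (N * m₃)) mfel) (padThen hmM E₂)) := by
      have hC₂' : distinguishingAdvantage (discretizedGaussian Q α₂) (max (G * (N * m₃)) mfel) (raiseThen (discretizedGaussian Q u) (max (G * (N * m₃)) mfel) (padThen hmM E₂)) =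
          distinguishingAdvantage (addConv (discretizedGaussian Q α₂) (discretizedGaussian Q u)) (G * (N * m₃)) E₂ := by
        rw [distinguishingAdvantage_raiseThen, distinguishingAdvantage_padThen]
      have habs := abs_distinguishingAdvantage_sub_le (ι := Fin d) (addConv (discretizedGaussian Q α₂) (discretizedGaussian Q u)) χh (G * (N * m₃)) E₂
      have htv := tvDist_addConv_discretizedGaussian_le Q hα₂ u
      rw [abs_le] at habs
      rw [hC₂', hχh]
      rw [hχh] at habs
      nlinarith [habs.1, mul_le_mul_of_nonneg_left htv (Nat.cast_nonneg (G * (N * m₃)))]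
    have hclose := distinguishingAdvantage_raiseThen_close (discretizedGaussian Q α₂) (m := max (G * (N * m₃)) mfel) hχut (padThen hmM E₂)
    linarith
  have hcases := exists_ge_of_weighted_sum_ge (x₁ := distinguishingAdvantage (discretizedGaussian Q α₂) mfel E₁)
    (x₂ := distinguishingAdvantage χh (G * (N * m₃)) E₂) (x₃ := distinguishingAdvantage (discretizedGaussian Q α₂) mfel E₃)
    (ℓ := ∑ p ∈ Q.primeFactors, ((p : ℝ) ^ (d + 1))⁻¹ + L47) (Nat.cast_nonneg (G * (N * m₃))) hsum
  have hE : candVec χh χN ζ χut R47 A' = ![padThen hfM E₁, raiseThen χut (max (G * (N * m₃)) mfel) (padThen hmM E₂), padThen hfM E₃] := rfl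
  have hraise0 : 0 ≤ ((G * (N * m₃) : ℕ) : ℝ) * (1 / (2 * Q * α₂)) := by
    have hQ : (0 : ℝ) < Q := by exact_mod_cast Nat.pos_of_ne_zero (NeZero.ne Q)
    positivity
  have hνu0 : 0 ≤ ((max (G * (N * m₃)) mfel : ℕ) : ℝ) * νu :=
    mul_nonneg (Nat.cast_nonneg _) ((PMF.tvDist_nonneg _ _).trans hχut)
  have hbest : ∃ i, ηstar ≤ distinguishingAdvantage (discretizedGaussian Q α₂) (max (G * (N * m₃)) mfel) (candVec χh χN ζ χut R47 A' i) := by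
    rw [hE]
    rcases hcases with h1 | h2 | h3
    · refine ⟨0, ?_⟩
      show ηstar ≤ distinguishingAdvantage (discretizedGaussian Q α₂) (max (G * (N * m₃)) mfel) (padThen hfM E₁)
      rw [hA₁]; linarith [hraise0, hνu0]
    · refine ⟨1, ?_⟩
      show ηstar ≤ distinguishingAdvantage (discretizedGaussian Q α₂) (max (G * (N * m₃)) mfel) (raiseThen χut (max (G * (N * m₃)) mfel) (padThen hmM E₂))
      linarith
    · refine ⟨2, ?_⟩
      show ηstar ≤ distinguishingAdvantage (discretizedGaussian Q α₂) (max (G * (N * m₃)) mfel) (padThen hfM E₃)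
      rw [hA₃]; linarith [hraise0, hνu0]
  exact hbest

/-- **BLPRS §4 for the machine, with approximate candidates**: as `section4_selected_explicit`, for any candidate vector `Ẽ` whose acceptance probabilities on
`A_{s,Ψ̄_Q(α₂)}` (`s ← U`) and on uniform tuples are within `ν_E` of those of `candVec`; the guarantee holds with `η⋆ − 2ν_E` in place of `η⋆`.
[cite: BrakerskiEtAl2013, Thm. 4.1 (proof) and §5; Goldreich2001, §3.2.1] -/
theorem section4_selected_explicit_close {ε α₀ α₂ u η₀ L47 ν νu νE δ : ℝ} (Nsel : ℕ) (hn : 0 < n) (hε : 0 < ε) (hε' : ε ≤ 1 / 2)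
    (hr : max (Q : ℝ)⁻¹ (q' : ℝ)⁻¹ * Real.sqrt (2 * Real.log (2 * n * (1 + 1 / ε)) / π) ≤ r) (hα₀ : 0 < α₀) (hα₂ : 0 < α₂)
    (hG : 0 < G) (hN : 0 < N) (hN' : 0 < N') (hm₃ : 0 < m₃) (hθ : 0 < θ) (hNsel : 0 < Nsel)
    (K : (Fin m₃ → (Fin n → ZMod q') × ZMod q') → PMF Bool)
    (A' : Distinguisher (Fin n) (ZMod Q) (G * (N * m₃)))
    (hA' : ∀ P : PMF (Fin (G * (N * m₃)) → (Fin n → ZMod Q) × ZMod Q),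
      |(acceptProb A' P).toReal -
        (acceptProb (flatGuessTest K N m₃ (rateGuessKernel n Q q' r B τ m₃) (uniformSamples (Fin n) (ZMod q') m₃) N' θ) P).toReal| ≤ ν)
    (χN : PMF (Fin n → ℤ)) (ρ₀ : (Fin n → ZMod Q) → ℝ) (ζ : PMF (Fin n → ℤ))
    (hζ : ∀ z ∈ ζ.support, ∀ i, z i = 0 ∨ z i = 1)
    (hnoise : ∀ z ∈ ζ.support, (noiseH₁ χN (discretizedGaussian Q (Real.sqrt (α₂ ^ 2 + u ^ 2))) (intCastVec z : Fin n → ZMod Q)).tvDist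
      (discretizedGaussian Q (ρ₀ (intCastVec z))) ≤ η₀)
    (hζ' : ∀ z ∈ ζ.support, ‖intVecToEuclidean n z‖ ≤ B ∧ α₀ ≤ ρ₀ (intCastVec z) ∧
      ∃ w : Fin G, 4 * θ ≤ distinguishingAdvantage (discretizedGaussian q'
        (Real.sqrt (Real.sqrt (ρ₀ (intCastVec z) ^ 2 + r ^ 2 * (‖intVecToEuclidean n z‖ ^ 2 + B ^ 2)) ^ 2 + τ w ^ 2))) m₃ K)
    (hεθ : m₃ * (4 * ε) ≤ θ / 2) (hQθ : m₃ * (2 / (α₀ * Q) + 10 * ε) + m₃ * η₀ ≤ 2 * θ)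
    (R47 : R47Type n d Q mfel)
    (h47 : ∀ ζ' : PMF (Fin n → ℤ), (∀ z ∈ ζ'.support, ∀ i, z i = 0 ∨ z i = 1) →
      ∀ D : (Fin n → ℤ) × (Matrix (Fin (d + 1)) (Fin n) (ZMod Q) × (Fin 1 → (Fin n → ZMod Q) × ℤ)) → PMF Bool,
        extLWEAdvantageZ ζ' χN 1 D ≤ felAdvantage (discretizedGaussian Q α₂) mfel (R47 ζ' D) + L47)
    (χut : PMF (ZMod Q)) (hχut : χut.tvDist (discretizedGaussian Q u) ≤ νu)
    {ηstar : ℝ} (hηE : 2 * νE < ηstar)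
    (hη : ηstar ≤ (1 - ((G + 1) * (4 / (N * θ ^ 2)) + 8 / (N' * θ ^ 2)) - 2 * ν -
          (lawCz (d + 1) ζ).tvDist (PMF.uniformOfFintype (Matrix (Fin (d + 1)) (Fin n) (ZMod Q) × (Fin (d + 1) → ZMod Q))) -
          2 * (G * (N * m₃) : ℕ) * (∑ p ∈ Q.primeFactors, ((p : ℝ) ^ (d + 1))⁻¹ + L47)) / (2 * (G * (N * m₃) : ℕ) + 1) -
        (G * (N * m₃) : ℕ) * (1 / (2 * Q * α₂)) - 2 * ((max (G * (N * m₃)) mfel : ℕ) * νu))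
    (Etil : Fin (2 + 1) → Distinguisher (Fin d) (ZMod Q) (max (G * (N * m₃)) mfel))
    (hEtil : haveI : NeZero (G * (N * m₃)) := ⟨(Nat.mul_pos hG (Nat.mul_pos hN hm₃)).ne'⟩
      ∀ i, |(acceptProb (Etil i) (lweSamplesUniformSecret (discretizedGaussian Q α₂) (max (G * (N * m₃)) mfel))).toReal -
          (acceptProb (candVec (discretizedGaussian Q (Real.sqrt (α₂ ^ 2 + u ^ 2))) χN ζ χut R47 A' i)
            (lweSamplesUniformSecret (discretizedGaussian Q α₂) (max (G * (N * m₃)) mfel))).toReal| ≤ νE ∧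
        |(acceptProb (Etil i) (uniformSamples (Fin d) (ZMod Q) (max (G * (N * m₃)) mfel))).toReal -
          (acceptProb (candVec (discretizedGaussian Q (Real.sqrt (α₂ ^ 2 + u ^ 2))) χN ζ χut R47 A' i)
            (uniformSamples (Fin d) (ZMod Q) (max (G * (N * m₃)) mfel))).toReal| ≤ νE)
    (Est : PMF (Fin (2 + 1) → (Fin Nsel → Bool) × (Fin Nsel → Bool)))
    (hEst : Est.tvDist (candEstLaw (discretizedGaussian Q α₂) Etil Nsel) ≤ δ) :
    (ηstar - 2 * νE) / 2 - 2 * ((2 + 1 : ℕ) * (32 / (Nsel * (ηstar - 2 * νE) ^ 2))) - 2 * δ ≤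
      distinguishingAdvantage (discretizedGaussian Q α₂) (max (G * (N * m₃)) mfel) (selectWith Etil Nsel Est) := by
  haveI : NeZero (G * (N * m₃)) := ⟨(Nat.mul_pos hG (Nat.mul_pos hN hm₃)).ne'⟩
  have hbest : ∃ i, ηstar - 2 * νE ≤ distinguishingAdvantage (discretizedGaussian Q α₂) (max (G * (N * m₃)) mfel) (Etil i) := by
    obtain ⟨i, hi⟩ := exists_candVec_advantage_ge (d := d) (mfel := mfel) hn hε hε' hr hα₀ hα₂ hG hN hN' hm₃ hθ K A' hA' χN ρ₀ ζ hζ hnoise hζ' hεθ hQθ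
      R47 h47 χut hχut hη
    refine ⟨i, ?_⟩
    have hclose := distinguishingAdvantage_ge_of_acceptProb_close (discretizedGaussian Q α₂) _ _ (hEtil i).1 (hEtil i).2
    linarith
  exact distinguishingAdvantage_selectWith_ge (discretizedGaussian Q α₂) hNsel (by linarith) hbest Est hEst

end Selected

end BLPRS2013

end Literature.Computability.Cryptography

end
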